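import Summits.AtomisticToContinuum.FouriersLaw.Theorems.HonestZwanzigNetworkReductionPackage

/-!
# `HonestZwanzig.RobinCoercivity` — block memory form, part 1: incidence bookkeeping and time reversal

Support file (`--supports` the crux `RobinCoercivity`, stmt-AtomisticToContinuum-12695, of route `HonestZwanzig`,
sub-problem `FouriersLaw`; auxiliary to stub `stub_blockForm` of line `limit-operator-memory-form`, skeleton
`Cruxes/RobinCoercivity/Lines/limit_operator_memory_form.lean`, proved in `…StubBlockForm`).

Positions `i : Fin (N+1)`: `0` = left contact, `1 … N−1` = bonds `b = i−1`, `N` = right contact. The Robin incidence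
is `(Bξ)_0 = ξ_0`, `(Bξ)_i = ξ_i − ξ_{i−1}` (`1 ≤ i ≤ N−1`), `(Bξ)_N = ξ_{N−1}`; the position observables are
`g_i = Σ_b [b+1 = i] j_b + [i = 0]γ(T − p_0²) + [i = N]γ(T − p_{N−1}²)`. Here: the rows of `B` in closed form,
`|Bξ|² =` the crux's Robin form (`blockForm_robin`), the pointwise incidence identities behind
`Σ_i (Bξ)_i g_i = j_ξ + w_ξ` (`blockForm_bond_sum`, `blockForm_contact_sum`), time reversal of the Schur pairing
(`schur_rev`, from `lap_rev`, `pkg_G_symm`, `e_neg_momentum`) and the symmetry of the block memory matrix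
`W_N(s)_{ij} = γT²·[i = j contact] − schur_s(g_i∘Θ, g_j)` (`blockForm_symm`). Gadgets `corr, lap, cov, e, Adm` are
abstract with their defining equations, under the fixed-`N` package `hFI` (= route item `FeshbachIdentities`), as in
`…NetworkReductionPackage`.
-/

noncomputable section

open MeasureTheory Finset Matrix
open Literature.MathematicalPhysics.KineticTheory.HeatConduction
open Summit.AtomisticToContinuum.FouriersLaw.Theorems.HonestZwanzig.NetworkReduction

namespace Summit.AtomisticToContinuum.FouriersLaw.Theorems.HonestZwanzig.Robin

/-! ### One-point indicator sums on `Fin M` -/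

/-- If `p` holds exactly at `a`, then `Σ_x [p x] f x = f a`. -/
theorem sum_ite_eq_of_unique {M : ℕ} {p : Fin M → Prop} [DecidablePred p] (f : Fin M → ℝ) (a : Fin M)
    (ha : p a) (h : ∀ x, p x → x = a) : (∑ x, if p x then f x else 0) = f a := by
  rw [Finset.sum_eq_single a, if_pos ha]
  · intro x _ hx
    exact if_neg fun hp => hx (h x hp)
  · intro hna
    exact absurd (Finset.mem_univ a) hna

/-- If `p` never holds, then `Σ_x [p x] f x = 0`. -/
theorem sum_ite_eq_zero_of_forall_not {M : ℕ} {p : Fin M → Prop} [DecidablePred p] (f : Fin M → ℝ)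
    (h : ∀ x, ¬p x) : (∑ x, if p x then f x else 0) = 0 :=
  Finset.sum_eq_zero fun x _ => if_neg (h x)

/-- In `Fin (N+1)` with `N ≥ 1`, the two contact positions `0` and `N` differ. -/
theorem zero_ne_last {N : ℕ} (hN : 1 ≤ N) : (0 : Fin (N + 1)) ≠ Fin.last N := by
  intro h
  have h' := congrArg Fin.val h
  rw [Fin.val_zero, Fin.val_last] at h'
  omega

/-! ### The Robin incidence on positions `Fin (N+1)` -/

section Incidence

variable {N : ℕ} (Bv : (Fin N → ℝ) → Fin (N + 1) → ℝ)
  (hBv : ∀ ξ i, Bv ξ i = if i.val = N then (∑ x : Fin N, if x.val + 1 = N then ξ x else 0)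
    else ∑ x : Fin N, ((if x.val = i.val then ξ x else 0) - (if x.val + 1 = i.val then ξ x else 0)))
include hBv

/-- The left contact row: `(Bξ)_0 = ξ_0`. -/
theorem blockForm_Bv_zero (hN : 1 ≤ N) (ξ : Fin N → ℝ) : Bv ξ 0 = ξ ⟨0, hN⟩ := by
  have h1 : (∑ x : Fin N, if x.val = ((0 : Fin (N + 1)) : ℕ) then ξ x else 0) = ξ ⟨0, hN⟩ :=
    sum_ite_eq_of_unique ξ ⟨0, hN⟩ rfl (fun x hx => Fin.ext hx)
  have h2 : (∑ x : Fin N, if x.val + 1 = ((0 : Fin (N + 1)) : ℕ) then ξ x else 0) = 0 :=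
    sum_ite_eq_zero_of_forall_not ξ (fun x => Nat.succ_ne_zero x.val)
  have h0 : ((0 : Fin (N + 1)) : ℕ) ≠ N := by
    rw [Fin.val_zero]
    omega
  rw [hBv, if_neg h0, Finset.sum_sub_distrib, h1, h2, sub_zero]

/-- The right contact row: `(Bξ)_N = ξ_{N−1}`. -/
theorem blockForm_Bv_last (hN : 1 ≤ N) (ξ : Fin N → ℝ) : Bv ξ (Fin.last N) = ξ ⟨N - 1, by omega⟩ := by
  rw [hBv, if_pos (Fin.val_last N)]
  exact sum_ite_eq_of_unique ξ ⟨N - 1, by omega⟩ (Nat.sub_add_cancel hN)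
    (fun x hx => Fin.ext (by show x.val = N - 1; omega))

/-- An interior bond row: `(Bξ)_{b+1} = ξ_{b+1} − ξ_b` (`b + 1 < N`). -/
theorem blockForm_Bv_succ (ξ : Fin N → ℝ) (b : Fin N) (hb : b.val + 1 < N) :
    Bv ξ b.succ = ξ ⟨b.val + 1, hb⟩ - ξ b := by
  have h1 : (∑ x : Fin N, if x.val = ((b.succ : Fin (N + 1)) : ℕ) then ξ x else 0) = ξ ⟨b.val + 1, hb⟩ :=
    sum_ite_eq_of_unique ξ ⟨b.val + 1, hb⟩ rfl (fun x hx => Fin.ext hx)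
  have h2 : (∑ x : Fin N, if x.val + 1 = ((b.succ : Fin (N + 1)) : ℕ) then ξ x else 0) = ξ b :=
    sum_ite_eq_of_unique ξ b rfl (fun x hx => Fin.ext (by rw [Fin.val_succ] at hx; omega))
  have hne : ((b.succ : Fin (N + 1)) : ℕ) ≠ N := by
    rw [Fin.val_succ]
    omega
  rw [hBv, if_neg hne, Finset.sum_sub_distrib, h1, h2]

/-- The last bond position is the right contact: `(Bξ)_{b+1} = ξ_b` when `b + 1 = N`. -/
theorem blockForm_Bv_succ_last (ξ : Fin N → ℝ) (b : Fin N) (hb : b.val + 1 = N) : Bv ξ b.succ = ξ b := by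
  have heq : ((b.succ : Fin (N + 1)) : ℕ) = N := by
    rw [Fin.val_succ]
    exact hb
  rw [hBv, if_pos heq]
  exact sum_ite_eq_of_unique ξ b hb (fun x hx => Fin.ext (by omega))

/-- **The bond part of `Σ_i (Bξ)_i g_i` is the odd observable `j_ξ`** (pointwise, at fixed bond-current values
`J_b`, with `J_{N−1} = 0`): `Σ_i (Bξ)_i Σ_b [b+1 = i] J_b = Σ_x ξ_x Σ_b ([x = b+1] − [b = x]) J_b`. -/
theorem blockForm_bond_sum (ξ : Fin N → ℝ) (J : Fin N → ℝ) (hJ : ∀ b : Fin N, ¬ b.val + 1 < N → J b = 0) :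
    ∑ i, Bv ξ i * (∑ b : Fin N, if b.val + 1 = i.val then J b else 0) =
      ∑ x, ξ x * ∑ b, ((if x.val = b.val + 1 then J b else 0) - (if b = x then J b else 0)) := by
  have hL : ∑ i, Bv ξ i * (∑ b : Fin N, if b.val + 1 = i.val then J b else 0) = ∑ b, Bv ξ b.succ * J b := by
    simp only [Finset.mul_sum, mul_ite, mul_zero]
    rw [Finset.sum_comm]
    refine Finset.sum_congr rfl fun b _ => ?_
    exact sum_ite_eq_of_unique (fun i => Bv ξ i * J b) b.succ (Fin.val_succ b).symm
      (fun i hi => Fin.ext (by rw [Fin.val_succ]; omega))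
  have hR : ∑ x, ξ x * ∑ b, ((if x.val = b.val + 1 then J b else 0) - (if b = x then J b else 0)) =
      ∑ b, Bv ξ b.succ * J b := by
    simp only [Finset.mul_sum]
    rw [Finset.sum_comm]
    refine Finset.sum_congr rfl fun b _ => ?_
    by_cases hb : b.val + 1 < N
    · have hA : (∑ x : Fin N, if x.val = b.val + 1 then ξ x * J b else 0) = ξ ⟨b.val + 1, hb⟩ * J b :=
        sum_ite_eq_of_unique (fun x => ξ x * J b) ⟨b.val + 1, hb⟩ rfl (fun x hx => Fin.ext hx)
      have hB : (∑ x : Fin N, if b = x then ξ x * J b else 0) = ξ b * J b :=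
        sum_ite_eq_of_unique (fun x => ξ x * J b) b rfl (fun x hx => hx.symm)
      simp only [mul_sub, mul_ite, mul_zero, Finset.sum_sub_distrib]
      rw [hA, hB, blockForm_Bv_succ Bv hBv ξ b hb]
      ring
    · rw [hJ b hb]
      simp
  rw [hL, hR]

/-- **The contact part of `Σ_i (Bξ)_i g_i` is the even observable `w_ξ`** (pointwise, at fixed contact values
`c_x`): `Σ_i (Bξ)_i Σ_x [(i = 0 ∧ x = 0) ∨ (i = N ∧ x+1 = N)] c_x = Σ_x ξ_x ([x = 0] c_x + [x = N−1] c_x)`. -/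
theorem blockForm_contact_sum (hN : 1 ≤ N) (ξ : Fin N → ℝ) (c : Fin N → ℝ) :
    ∑ i, Bv ξ i * (∑ x : Fin N, if (i.val = 0 ∧ x.val = 0) ∨ (i.val = N ∧ x.val + 1 = N) then c x else 0) =
      ∑ x, ξ x * ((if x.val = 0 then c x else 0) + (if x.val = N - 1 then c x else 0)) := by
  rw [Fintype.sum_eq_add (0 : Fin (N + 1)) (Fin.last N) (zero_ne_last hN)]
  · have hA : (∑ x : Fin N, if (((0 : Fin (N + 1)) : ℕ) = 0 ∧ x.val = 0) ∨
        (((0 : Fin (N + 1)) : ℕ) = N ∧ x.val + 1 = N) then c x else 0) = c ⟨0, hN⟩ :=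
      sum_ite_eq_of_unique c ⟨0, hN⟩ (Or.inl ⟨Fin.val_zero (N + 1), rfl⟩) (fun x hx => by
        rcases hx with ⟨-, hx⟩ | ⟨h1, -⟩
        · exact Fin.ext hx
        · rw [Fin.val_zero] at h1; omega)
    have hB : (∑ x : Fin N, if (((Fin.last N : Fin (N + 1)) : ℕ) = 0 ∧ x.val = 0) ∨
        (((Fin.last N : Fin (N + 1)) : ℕ) = N ∧ x.val + 1 = N) then c x else 0) = c ⟨N - 1, by omega⟩ :=
      sum_ite_eq_of_unique c ⟨N - 1, by omega⟩ (Or.inr ⟨Fin.val_last N, Nat.sub_add_cancel hN⟩) (fun x hx => by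
        rcases hx with ⟨h1, -⟩ | ⟨-, hx⟩
        · rw [Fin.val_last] at h1; omega
        · exact Fin.ext (by show x.val = N - 1; omega))
    have hC : (∑ x : Fin N, if x.val = 0 then ξ x * c x else 0) = ξ ⟨0, hN⟩ * c ⟨0, hN⟩ :=
      sum_ite_eq_of_unique (fun x => ξ x * c x) ⟨0, hN⟩ rfl (fun x hx => Fin.ext hx)
    have hD : (∑ x : Fin N, if x.val = N - 1 then ξ x * c x else 0) = ξ ⟨N - 1, by omega⟩ * c ⟨N - 1, by omega⟩ :=
      sum_ite_eq_of_unique (fun x => ξ x * c x) ⟨N - 1, by omega⟩ rfl (fun x hx => Fin.ext hx)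
    rw [hA, hB, blockForm_Bv_zero Bv hBv hN, blockForm_Bv_last Bv hBv hN]
    simp only [mul_add, mul_ite, mul_zero, Finset.sum_add_distrib]
    rw [hC, hD]
  · rintro i ⟨hi0, hiN⟩
    have hi0' : i.val ≠ 0 := fun h => hi0 (Fin.ext (by rw [h, Fin.val_zero]))
    have hiN' : i.val ≠ N := fun h => hiN (Fin.ext (by rw [h, Fin.val_last]))
    have hz : (∑ x : Fin N, if (i.val = 0 ∧ x.val = 0) ∨ (i.val = N ∧ x.val + 1 = N) then c x else 0) = 0 :=
      Finset.sum_eq_zero fun x _ => if_neg (by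
        rintro (⟨h, -⟩ | ⟨h, -⟩)
        exacts [hi0' h, hiN' h])
    rw [hz, mul_zero]

end Incidence

/-- **Registered sub-goal `blockForm_robin` (claim (4) of `stub_blockForm`): `|Bξ|²` is the crux's Robin form**
`Σ_i (Σ_j [j = i+1](ξ_j − ξ_i)² + [i = 0]ξ_i² + [i = N−1]ξ_i²)` on the positions `Fin (N+1)`. -/
theorem blockForm_robin {N : ℕ} (Bv : (Fin N → ℝ) → Fin (N + 1) → ℝ)
    (hBv : ∀ ξ i, Bv ξ i = if i.val = N then (∑ x : Fin N, if x.val + 1 = N then ξ x else 0)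
      else ∑ x : Fin N, ((if x.val = i.val then ξ x else 0) - (if x.val + 1 = i.val then ξ x else 0)))
    (hN : 1 ≤ N) (ξ : Fin N → ℝ) :
    ∑ i, Bv ξ i ^ 2 = (∑ i : Fin N, ((∑ j : Fin N, if j.val = i.val + 1 then (ξ j - ξ i) ^ 2 else 0) +
      (if i.val = 0 then ξ i ^ 2 else 0) + (if i.val = N - 1 then ξ i ^ 2 else 0))) := by
  rw [Fin.sum_univ_succ, blockForm_Bv_zero Bv hBv hN ξ]
  have h0 : (∑ i : Fin N, if i.val = 0 then ξ i ^ 2 else 0) = ξ ⟨0, hN⟩ ^ 2 :=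
    sum_ite_eq_of_unique (fun i => ξ i ^ 2) ⟨0, hN⟩ rfl (fun x hx => Fin.ext hx)
  have hb : ∀ b : Fin N, Bv ξ b.succ ^ 2 = (∑ j : Fin N, if j.val = b.val + 1 then (ξ j - ξ b) ^ 2 else 0) +
      (if b.val = N - 1 then ξ b ^ 2 else 0) := by
    intro b
    by_cases hb : b.val + 1 < N
    · have h1 : (∑ j : Fin N, if j.val = b.val + 1 then (ξ j - ξ b) ^ 2 else 0) = (ξ ⟨b.val + 1, hb⟩ - ξ b) ^ 2 :=
        sum_ite_eq_of_unique (fun j => (ξ j - ξ b) ^ 2) ⟨b.val + 1, hb⟩ rfl (fun x hx => Fin.ext hx)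
      rw [blockForm_Bv_succ Bv hBv ξ b hb, h1, if_neg (show ¬(b.val = N - 1) by omega), add_zero]
    · have hb' : b.val + 1 = N := by omega
      have h1 : (∑ j : Fin N, if j.val = b.val + 1 then (ξ j - ξ b) ^ 2 else 0) = 0 :=
        sum_ite_eq_zero_of_forall_not (fun j => (ξ j - ξ b) ^ 2) (fun x hx => by omega)
      rw [blockForm_Bv_succ_last Bv hBv ξ b hb', h1, if_pos (show b.val = N - 1 by omega), zero_add]
  simp only [hb, Finset.sum_add_distrib]
  rw [h0]
  ring

/-! ### Fixed `N`, fixed `s`: the gadgets of the route with their defining equations -/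

section FixedN

variable {ω₂ lam β γ : ℝ} {N : ℕ} {T : ℝ}
  {Adm : (PhaseSpace N → ℝ) → Prop}
  {corr : (PhaseSpace N → ℝ) → (PhaseSpace N → ℝ) → ℝ → ℝ}
  {lap : ℝ → (PhaseSpace N → ℝ) → (PhaseSpace N → ℝ) → ℝ}
  {cov : (PhaseSpace N → ℝ) → (PhaseSpace N → ℝ) → ℝ}
  {e : Fin N → PhaseSpace N → ℝ}
  (hAdm : ∀ f, Adm f ↔ (Continuous f ∧ ∃ A : ℝ, ∀ z,
    |f z| ≤ A * Real.exp ((pinnedChain ω₂ lam β γ).hamiltonian N z / (8 * T))))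
  (hlap : ∀ s f g, lap s f g = ∫ t in Set.Ioi (0 : ℝ), Real.exp (-(s * t)) * corr f g t)
  (he : ∀ x z, e x z = z.2 x ^ 2 / 2 + (pinnedChain ω₂ lam β γ).U (z.1 x) +
    ∑ j : Fin N, ((if j.val = x.val + 1 then (pinnedChain ω₂ lam β γ).V (z.1 j - z.1 x) / 2 else 0) +
      (if x.val = j.val + 1 then (pinnedChain ω₂ lam β γ).V (z.1 x - z.1 j) / 2 else 0)))
  (hFI : ∀ f g : PhaseSpace N → ℝ, Adm f → Adm g →
    Integrable f ((pinnedChain ω₂ lam β γ).gibbsMeasure N T) ∧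
    (∀ t : ℝ, 0 ≤ t → Integrable (fun z => f z *
      (∫ y, g y ∂((pinnedChain ω₂ lam β γ).transitionKernel N T T t.toNNReal z)))
      ((pinnedChain ω₂ lam β γ).gibbsMeasure N T)) ∧
    IntegrableOn (corr f g) (Set.Ioi 0) ∧
    (∀ t : ℝ, 0 ≤ t → corr f g t = corr (fun z => g (z.1, -z.2)) (fun z => f (z.1, -z.2)) t) ∧
    (∀ s : ℝ, 0 < s → ∀ x : Fin N,
      s * lap s (e x) g - cov (e x) g =
        lap s (fun z => (pinnedChain ω₂ lam β γ).generator N T T (e x) (z.1, -z.2)) g ∧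
      s * lap s f (e x) - cov f (e x) = lap s f ((pinnedChain ω₂ lam β γ).generator N T T (e x))))
  (hω : 0 < ω₂) (hl : 0 ≤ lam) (hβ : 0 ≤ β) (hT : 0 < T)
  (g : Fin (N + 1) → PhaseSpace N → ℝ)
  (hg : ∀ i z, g i z = (∑ b : Fin N, if b.val + 1 = i.val then (pinnedChain ω₂ lam β γ).bondCurrent N b z else 0) +
    (∑ x : Fin N, if (i.val = 0 ∧ x.val = 0) ∨ (i.val = N ∧ x.val + 1 = N) then
      (pinnedChain ω₂ lam β γ).γ * (T - z.2 x ^ 2) else 0))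

include hAdm hlap he hFI hω hl hβ hT in
/-- **Time reversal for the Schur pairing**: `schur_s(f∘Θ, h) = schur_s(h∘Θ, f)` for admissible `f, h`, when
`G = G(s)` (symmetric, `pkg_G_symm`) and the site energies are even (`e_neg_momentum`). -/
theorem schur_rev {s : ℝ} (G : Matrix (Fin N) (Fin N) ℝ) (hG : ∀ x y, G x y = lap s (e x) (e y))
    (schur : (PhaseSpace N → ℝ) → (PhaseSpace N → ℝ) → ℝ)
    (hschur : ∀ f g, schur f g = lap s f g - ∑ u, ∑ v, lap s f (e u) * G⁻¹ u v * lap s (e v) g)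
    {f h : PhaseSpace N → ℝ} (hf : Adm f) (hh : Adm h) :
    schur (fun z => f (z.1, -z.2)) h = schur (fun z => h (z.1, -z.2)) f := by
  classical
  have hex : ∀ x, Adm (e x) := fun x => adm_e Adm hAdm e he hω hl hβ hT x
  have hefun : ∀ u, (fun z : PhaseSpace N => e u (z.1, -z.2)) = e u :=
    fun u => funext fun z => e_neg_momentum _ e he u z
  have hfr : Adm (fun z => f (z.1, -z.2)) := adm_rev Adm hAdm hf
  have hff : (fun z : PhaseSpace N => (fun w : PhaseSpace N => f (w.1, -w.2)) (z.1, -z.2)) = f :=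
    funext fun z => by simp
  have h1 : lap s (fun z => f (z.1, -z.2)) h = lap s (fun z => h (z.1, -z.2)) f := by
    rw [lap_rev hlap hFI hfr hh, hff]
  have h2 : ∀ u, lap s (fun z => f (z.1, -z.2)) (e u) = lap s (e u) f := fun u => by
    rw [lap_rev hlap hFI hfr (hex u), hefun, hff]
  have h3 : ∀ v, lap s (e v) h = lap s (fun z => h (z.1, -z.2)) (e v) := fun v => by
    rw [lap_rev hlap hFI (hex v) hh, hefun]
  have hGsym : ∀ x y, G x y = G y x := fun x y => by rw [hG, hG, pkg_G_symm hAdm hlap he hFI hω hl hβ hT s]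
  have hGT : Gᵀ = G := transpose_eq_of_symm G hGsym
  have hGinv : ∀ u v, G⁻¹ u v = G⁻¹ v u := fun u v => by
    have := congrFun (congrFun (Matrix.transpose_nonsing_inv G) v) u
    rw [hGT, Matrix.transpose_apply] at this
    exact this
  rw [hschur, hschur, h1]
  simp only [h2, h3]
  congr 1
  rw [Finset.sum_comm]
  refine Finset.sum_congr rfl fun u _ => Finset.sum_congr rfl fun v _ => ?_
  rw [hGinv v u]
  ring

include hAdm hω hl hβ hT hg in
/-- Every position observable `g_i` is admissible. -/
theorem blockForm_adm_g (i : Fin (N + 1)) : Adm (g i) := by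
  refine adm_of_eq Adm (hg i) (adm_add Adm hAdm ?_ ?_)
  · refine adm_sum Adm hAdm Finset.univ _ (adm_const Adm hAdm hω hl hβ hT 0) fun b _ => ?_
    exact adm_ite Adm _ (adm_bondCurrent Adm hAdm hω hl hβ hT b) (adm_const Adm hAdm hω hl hβ hT 0)
  · refine adm_sum Adm hAdm Finset.univ _ (adm_const Adm hAdm hω hl hβ hT 0) fun x _ => ?_
    exact adm_ite Adm _ (adm_const_mul Adm hAdm _ (adm_sub Adm hAdm (adm_const Adm hAdm hω hl hβ hT T)
      (adm_psq Adm hAdm hω hl hβ hT x))) (adm_const Adm hAdm hω hl hβ hT 0)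

include hg in
/-- Momentum reversal of a position observable: the bond part is odd, the contact part even. -/
theorem blockForm_g_rev (i : Fin (N + 1)) (z : PhaseSpace N) :
    g i (z.1, -z.2) = -(∑ b : Fin N, if b.val + 1 = i.val then (pinnedChain ω₂ lam β γ).bondCurrent N b z else 0) +
      (∑ x : Fin N, if (i.val = 0 ∧ x.val = 0) ∨ (i.val = N ∧ x.val + 1 = N) then
        (pinnedChain ω₂ lam β γ).γ * (T - z.2 x ^ 2) else 0) := by
  rw [hg]
  simp only [OscillatorChain.bondCurrent_neg_momentum, Pi.neg_apply, neg_sq]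
  congr 1
  rw [← Finset.sum_neg_distrib]
  refine Finset.sum_congr rfl fun b _ => ?_
  split_ifs <;> ring

include hAdm hlap he hFI hω hl hβ hT hg in
/-- **Symmetry of the block memory matrix** `W_N(s)_{ij} = γT²[i = j contact] − schur_s(g_i∘Θ, g_j)`. -/
theorem blockForm_symm {s : ℝ} (G : Matrix (Fin N) (Fin N) ℝ) (hG : ∀ x y, G x y = lap s (e x) (e y))
    (schur : (PhaseSpace N → ℝ) → (PhaseSpace N → ℝ) → ℝ)
    (hschur : ∀ f g, schur f g = lap s f g - ∑ u, ∑ v, lap s f (e u) * G⁻¹ u v * lap s (e v) g)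
    (W : Fin (N + 1) → Fin (N + 1) → ℝ)
    (hW : ∀ i j, W i j = (if i = j ∧ (i.val = 0 ∨ i.val = N) then (pinnedChain ω₂ lam β γ).γ * T ^ 2 else 0) -
      schur (fun z => g i (z.1, -z.2)) (g j))
    (i j : Fin (N + 1)) : W i j = W j i := by
  have hgadm : ∀ i, Adm (g i) := fun i => blockForm_adm_g hAdm hω hl hβ hT g hg i
  rw [hW, hW, schur_rev hAdm hlap he hFI hω hl hβ hT G hG schur hschur (hgadm i) (hgadm j)]
  congr 1
  by_cases hij : i = j
  · subst hij
    rfl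
  · rw [if_neg (show ¬(i = j ∧ (i.val = 0 ∨ i.val = N)) from fun h => hij h.1),
      if_neg (show ¬(j = i ∧ (j.val = 0 ∨ j.val = N)) from fun h => hij h.1.symm)]

end FixedN

end Summit.AtomisticToContinuum.FouriersLaw.Theorems.HonestZwanzig.Robin

end
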